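import Literature.MathematicalPhysics.QuantumFieldTheory.Balaban1983to89.T3AlphaInputsACTwoRunLevel
import Literature.MathematicalPhysics.QuantumFieldTheory.Balaban1983to89.T3Thresholds
import Summits.QuantumFields.Balaban3D.Proofs.Representation33
import HarnessLib

/-!
# `UnitScaleTiltFluctuationComparisonRegPrGlobalSlackKernelMatching` — THE K1a KERNEL-MATCHING INTERFACE (chart calculus) AND ITS COMPOSITION TO THE LOCAL SLACK ROW
# (crux `FluctuationComparisonRegPrL`, stmt-QuantumFields-19935, STUB 3⁗ `stub_globalTwoRunSlackFam`; width-lever lane A «order-σ matched height-free kernels»)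

PORT, VERBATIM (§0–§3b), of the crux-ideate workfile `Cruxes/FluctuationComparisonRegPr/Sketch_ideator1_g12.lean` (seat ym-cruxidea-19201-1 g12, finding F-idea1-g12-1,
crux write 2026-08-27T11:35Z) into the namespace `Summit.QuantumFields.YangMills.Theorems.GlobalSlackKernelMatching`, so that the 3⁗ line reads the interface rows and the
composition theorem BY NAME (OWNER ym3-torus-plan g20 sweep 2026-08-27T10:51:28Z, deliverable (ii) of the pen ★ym-ust-19935-slack; crux workfiles are not importable).
CREDIT: every declaration below is ym-cruxidea-19201-1 g12's; the porting seat (ym-ust-19935-slack g0) changed only this docstring, the imports and the namespace (the display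
audit §4 of the workfile, over `PkgAtV3`/`StepSeries`, is ported in a separate file).

CONTENT.  §0 carriers: CHART FAMILY `Φ K b Y : (PBond (F.P K) b → 𝕍) → ℂ` (run `K`, chart index `b`, domain `Y`; term level `1 + b`), FLAT KERNELS `ker Φ K b Y d :=
iteratedFDeriv ℂ d (Φ K b Y) 0` (the `jet26` coefficients, colour kept), bond `transport` along `matchBond`, TRANSPORTED KERNEL `kerT` (run `K+1` pulled back to run `K`);
configurations `B`, vacuum constants `e`, remainders `R`.  §1 the local slack row `PolymerCauchyMinAtTSlack` (verbatim sketches g9–g11; the hypothesis of g11's local→global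
producer, whose output `GlobalSlack.GlobalSupRateTSlack` is the tail of 3⁗) and its weighted form.  §2 rows: `TaylorSplitΦ` ((30)/(33)/(43)), `FlatKernelCauchyΦ` (K1a,
operator norm — THE UNPRINTED NUMBER COMPARISON, [King1986] Prop. 3.6 for SU(2) d = 3), `KernelSizeΦ` ((34)), `RemainderSmallΦ` ((57) + G3D-06), `CfgSizeΦ`, `CfgCauchyΦ`
(loss `ℓ(n) ≥ 1`; `ℓ ≡ 1` of record).  §3 (the algebra and the composition `polymerCauchyMinAtTSlack(W)_of_charts`, PROVED) is the companion file `…GlobalSlackKernelMatchingCompose`.  Every `def` here is a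
hypothesis schema (never asserted); the theorems are re-indexing identities.

References: C. King, CMP 102 (1986) 649–677 [King1986] (Thm 3.4 (3.9) p.656, (3.42) p.660, Prop. 3.6 (3.55)–(3.57) p.662, Props 3.8–3.9 (3.71)–(3.75) p.665);
T. Bałaban, CMP 102 (1985) 255–275 [Balaban1985UV3] ((27)–(30) p.263, (32)–(34) p.264, (43)–(44) pp.266–267, (57) p.270); CMP 109 (1987) 249–301 [Balaban1987RG1] ((0.1) p.251).
-/

set_option autoImplicit false

noncomputable section

open scoped BigOperators
open Literature.MathematicalPhysics.QuantumFieldTheory.Balaban1983to89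
open Literature.MathematicalPhysics.QuantumFieldTheory.Balaban1983to89.T3ContinuumYM3Torus
open Literature.MathematicalPhysics.QuantumFieldTheory.Balaban1983to89.T3UnitScaleTilt
open Literature.MathematicalPhysics.QuantumFieldTheory.Balaban1983to89.T3LevelShift
open Literature.MathematicalPhysics.QuantumFieldTheory.Balaban1983to89.T3AlphaInputsAC
open Literature.MathematicalPhysics.QuantumFieldTheory.Balaban1983to89.T3AlphaPolymerSocket
open Literature.MathematicalPhysics.QuantumFieldTheory.Balaban1983to89.T3AlphaInputsACTwoRun
open Literature.MathematicalPhysics.QuantumFieldTheory.Balaban1983to89.T3AlphaInputsACTwoRunLevel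
open Summit.QuantumFields.Balaban3D.Proofs.Representation33 (jet26)

namespace Summit.QuantumFields.YangMills.Theorems.GlobalSlackKernelMatching

/-! ## §0 Carriers: chart families, flat kernels, bond transport -/

/-- The bond matching of the two runs (level `b` of run `K` ≃ level `b+1` of run `K+1`; `T3LevelShift.bondShift`). [cite: Balaban1987RG1, (0.1) p.251] -/
def matchBond (F : T3Family) (K b : ℕ) : PBond (F.P K) b ≃ PBond (F.P (K + 1)) (b + 1) :=
  bondShift (F.sitesPerDir_eq (m := F.m) (K := K) (j := b) (m' := F.m) (K' := K + 1) (j' := b + 1) (by omega))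

/-- CHART FAMILY: run `K`, chart index `b` (the bond level of the chart variable; the terms are print's `𝒫_{b+1}`, the socket's term level `1 + b`), domain
`Y` ↦ an analytic chart on the configuration space `PBond (F.P K) b → 𝕍` (the lane's `StepSeries.Ψ` at step `b`, in its own 𝓗-currency; §4 (D1)).
[cite: Balaban1985UV3, (29)-(30) p.263, (33) p.264] -/
abbrev ChartFam (𝕍 : Type) (F : T3Family) : Type :=
  (K b : ℕ) → Set (Site (F.P K) 0) → ((PBond (F.P K) b → 𝕍) → ℂ)

/-- CONFIGURATION FAMILY: run `K`, lattice level `k`, chart index `b`, domain `Y`, level-`k` field `W` ↦ the chart configuration at which the level-`(1+b)` terms are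
read (`𝓗_b(B_{b+1})|_Y` of the level-`k` composite minimiser at the trivial history; at `k = b+1` the displayed `Bcfg`, §4 (D2)). [cite: Balaban1985UV3, (27) p.263, (43) p.266] -/
abbrev CfgFam (𝕍 : Type) (F : T3Family) : Type :=
  (K k b : ℕ) → Set (Site (F.P K) 0) → GaugeField (F.P K) k (Matrix.specialUnitaryGroup (Fin 2) ℂ) → (PBond (F.P K) b → 𝕍)

/-- VACUUM CONSTANTS `𝒫′(g, Y, 1)` (order 0 of (30); field-independent). [cite: Balaban1985UV3, (30)-(31) p.263] -/
abbrev VacFam (F : T3Family) : Type := (K b : ℕ) → Set (Site (F.P K) 0) → ℝ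

/-- REMAINDERS (order ≥ 7 of (30)/(57) and the far terms G3D-06, read at a level-`k` field). [cite: Balaban1985UV3, (57) p.270] -/
abbrev RemFam (F : T3Family) : Type :=
  (K k b : ℕ) → Set (Site (F.P K) 0) → GaugeField (F.P K) k (Matrix.specialUnitaryGroup (Fin 2) ℂ) → ℝ

section Kernels

variable {𝕍 : Type} [NormedAddCommGroup 𝕍] [NormedSpace ℂ 𝕍] {F : T3Family}

/-- **FLAT KERNEL** of order `d` of the chart `Φ K b Y`: its `d`-th Fréchet derivative at the flat point `0` — the coefficient `d`-linear map of `jet26`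
(`jet26 Ψ B = Σ_{d=2}^{6} (d!)⁻¹ • ker(B, …, B)`), a FIELD-INDEPENDENT object ([King1986] (3.55): graphs with the fields pulled out). [cite: King1986, (3.55) p.662] -/
def ker (Φ : ChartFam 𝕍 F) (K b : ℕ) (Y : Set (Site (F.P K) 0)) (d : ℕ) :
    ContinuousMultilinearMap ℂ (fun _ : Fin d => PBond (F.P K) b → 𝕍) ℂ :=
  iteratedFDeriv ℂ d (Φ K b Y) 0

variable (𝕍) in
/-- BOND TRANSPORT of configurations from run `K` (chart index `b`) to run `K+1` (chart index `b+1`) along `matchBond` (re-indexing; a linear isometry of the sup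
norms). [cite: Balaban1987RG1, (0.1) p.251] -/
def transport (F : T3Family) (K b : ℕ) : (PBond (F.P K) b → 𝕍) →L[ℂ] (PBond (F.P (K + 1)) (b + 1) → 𝕍) :=
  ContinuousLinearMap.pi fun c' => ContinuousLinearMap.proj ((matchBond F K b).symm c')

/-- The bond transport evaluates by re-indexing along `matchBond⁻¹` (definitional). [cite: Balaban1987RG1, (0.1) p.251] -/
theorem transport_apply (K b : ℕ) (x : PBond (F.P K) b → 𝕍) (c' : PBond (F.P (K + 1)) (b + 1)) :
    transport 𝕍 F K b x c' = x ((matchBond F K b).symm c') := rfl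

/-- The transport of the pull-back of a run-`(K+1)` configuration is that configuration. [folklore] -/
theorem transport_pullback (K b : ℕ) (x' : PBond (F.P (K + 1)) (b + 1) → 𝕍) :
    transport 𝕍 F K b (fun c => x' (matchBond F K b c)) = x' := by
  funext c'
  rw [transport_apply]
  exact congrArg x' ((matchBond F K b).apply_symm_apply c')

/-- **TRANSPORTED KERNEL**: the order-`d` flat kernel of run `K+1` at `(b+1, refineSet Y)` pulled back to run `K`'s chart space along the bond matching.
[cite: King1986, Prop. 3.6 (3.56) p.662] -/
def kerT (Φ : ChartFam 𝕍 F) (K b : ℕ) (Y : Set (Site (F.P K) 0)) (d : ℕ) :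
    ContinuousMultilinearMap ℂ (fun _ : Fin d => PBond (F.P K) b → 𝕍) ℂ :=
  (ker Φ (K + 1) (b + 1) (refineSet F K Y) d).compContinuousLinearMap fun _ => transport 𝕍 F K b

/-- The transported kernel on a constant tuple is the run-`(K+1)` kernel on the transported constant tuple (definitional). [cite: King1986, Prop. 3.6 (3.56) p.662] -/
theorem kerT_apply_const (Φ : ChartFam 𝕍 F) (K b : ℕ) (Y : Set (Site (F.P K) 0)) (d : ℕ) (x : PBond (F.P K) b → 𝕍) :
    kerT Φ K b Y d (fun _ => x) = ker Φ (K + 1) (b + 1) (refineSet F K Y) d (fun _ => transport 𝕍 F K b x) := by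
  simp [kerT, ContinuousMultilinearMap.compContinuousLinearMap_apply]

end Kernels

/-! ## §1 The local slack row (verbatim g9/g10/g11) -/

section Rows

variable {𝕍 : Type} [NormedAddCommGroup 𝕍] [NormedSpace ℂ 𝕍] {F : T3Family} {γ : ℝ}

/-- **THE TWO-CUT-OFF ROW WITH AN ADDITIVE SLACK** (`PolymerCauchyMinAtT` + `C·e^{−κ₁𝓛}·L^{−4(K−n−1−j)}·θ(n)^σ`; g9 §1, g10/g11 verbatim; consumed by g11's
`globalTwoRunSlackTail_of_polymerSlack` ⇒ `GlobalSupRateTSlack` = the tail of STUB 3⁗). [cite: King1986, Thm 3.4 (3.9) p.656] -/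
def PolymerCauchyMinAtTSlack (D : AlphaDataT3 F γ) (PT : TermFn F) (b₀ p₀ κ₁ a : ℝ) (σ : ℕ) (C : ℝ) : Prop :=
  ∃ c : (K n j : ℕ) → Set (Site (F.P K) 0) → ℝ,
    ∀ (K n : ℕ) (h : n ≤ K), ∀ j : ℕ, j < K - n →
      ∀ V : GaugeField (F.P n) 0 (Matrix.specialUnitaryGroup (Fin 2) ℂ), PlaqSmall (θBal F.L γ b₀ p₀ n) V →
        ∀ Y ∈ D.Loc K (K - n) (D.triv K (K - n)) (1 + j),
          |PT (K + 1) (K + 1 - n) (1 + (j + 1)) (refineSet F K Y)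
              (fieldShift (F.sitesPerDir_eq (m := F.m) (K := K + 1) (j := K + 1 - n) (m' := F.m) (K' := n) (j' := 0) (by omega)) V) -
            PT K (K - n) (1 + j) Y
              (fieldShift (F.sitesPerDir_eq (m := F.m) (K := K) (j := K - n) (m' := F.m) (K' := n) (j' := 0) (by omega)) V) -
            c K n j Y| ≤
          C * Real.exp (-κ₁ * D.treeLen K (1 + j) Y) * (((F.L : ℝ) ^ (K - n - 1 - j))⁻¹) ^ 4 *
            (θBal F.L γ b₀ p₀ n ^ 2 * (((F.L : ℝ) ^ (1 + j))⁻¹) ^ a + θBal F.L γ b₀ p₀ n ^ σ)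

/-- **THE LOCAL SLACK ROW WITH A GENERAL RATE WEIGHT** `w n` in place of `θ(n)²` (for the β-door of OWNER RULING g20-№11 ADDENDUM 2: [King1986] (3.42) p.660
prints the rate term with the per-site loss `(L^kε)^{−1/2}`, located at the configuration comparison (3.72) p.665; `w n := θ(n)²·ℓ(n)` with a loss `ℓ(n) ≥ 1`,
e.g. `L^{n/2}`, `θ(n)²ℓ(n) ≤ L^{βn}`).  `w n := θ(n)²` is the row of record VERBATIM (`slackW_theta_iff`). [cite: King1986, (3.42) p.660, (3.72) p.665] -/
def PolymerCauchyMinAtTSlackW (D : AlphaDataT3 F γ) (PT : TermFn F) (b₀ p₀ κ₁ a : ℝ) (σ : ℕ) (C : ℝ) (w : ℕ → ℝ) : Prop :=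
  ∃ c : (K n j : ℕ) → Set (Site (F.P K) 0) → ℝ,
    ∀ (K n : ℕ) (h : n ≤ K), ∀ j : ℕ, j < K - n →
      ∀ V : GaugeField (F.P n) 0 (Matrix.specialUnitaryGroup (Fin 2) ℂ), PlaqSmall (θBal F.L γ b₀ p₀ n) V →
        ∀ Y ∈ D.Loc K (K - n) (D.triv K (K - n)) (1 + j),
          |PT (K + 1) (K + 1 - n) (1 + (j + 1)) (refineSet F K Y)
              (fieldShift (F.sitesPerDir_eq (m := F.m) (K := K + 1) (j := K + 1 - n) (m' := F.m) (K' := n) (j' := 0) (by omega)) V) -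
            PT K (K - n) (1 + j) Y
              (fieldShift (F.sitesPerDir_eq (m := F.m) (K := K) (j := K - n) (m' := F.m) (K' := n) (j' := 0) (by omega)) V) -
            c K n j Y| ≤
          C * Real.exp (-κ₁ * D.treeLen K (1 + j) Y) * (((F.L : ℝ) ^ (K - n - 1 - j))⁻¹) ^ 4 *
            (w n * (((F.L : ℝ) ^ (1 + j))⁻¹) ^ a + θBal F.L γ b₀ p₀ n ^ σ)

/-- The row of record is the weighted row at `w n = θ(n)²` (definitional). [folklore] -/
theorem slackW_theta_iff (D : AlphaDataT3 F γ) (PT : TermFn F) (b₀ p₀ κ₁ a : ℝ) (σ : ℕ) (C : ℝ) :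
    PolymerCauchyMinAtTSlackW D PT b₀ p₀ κ₁ a σ C (fun n => θBal F.L γ b₀ p₀ n ^ 2) ↔ PolymerCauchyMinAtTSlack D PT b₀ p₀ κ₁ a σ C :=
  Iff.rfl

/-- A larger weight is a weaker row (e.g. `θ(n)²·ℓ(n) ≤ L^{βn}` for the β-form). [folklore] -/
theorem slackW_mono {D : AlphaDataT3 F γ} {PT : TermFn F} {b₀ p₀ κ₁ a : ℝ} {σ : ℕ} {C : ℝ} {w w' : ℕ → ℝ} (hC : 0 ≤ C)
    (hw : ∀ n, w n ≤ w' n) (h : PolymerCauchyMinAtTSlackW D PT b₀ p₀ κ₁ a σ C w) : PolymerCauchyMinAtTSlackW D PT b₀ p₀ κ₁ a σ C w' := by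
  obtain ⟨c, hc⟩ := h
  refine ⟨c, fun K n hn j hj V hV Y hY => (hc K n hn j hj V hV Y hY).trans ?_⟩
  have hP : 0 ≤ C * Real.exp (-κ₁ * D.treeLen K (1 + j) Y) * (((F.L : ℝ) ^ (K - n - 1 - j))⁻¹) ^ 4 :=
    mul_nonneg (mul_nonneg hC (Real.exp_pos _).le) (by positivity)
  have hρ : 0 ≤ (((F.L : ℝ) ^ (1 + j))⁻¹) ^ a := Real.rpow_nonneg (by positivity) _
  exact mul_le_mul_of_nonneg_left (add_le_add (mul_le_mul_of_nonneg_right (hw n) hρ) le_rfl) hP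

/-! ## §2 The rows of the K1a interface (chart calculus) -/

/-- **STRUCTURE ROW (Taylor form, chart calculus)**: the level-`(1+b)` term on `Y` read at a level-`k` field = vacuum constant + the order-2…6 jet of the chart
`Φ K b Y` at the configuration `B K k b Y W` (real part) + remainder.  For a coherent family this is `hPY`/`hPYZ` at the birth level and R-OLDFAC (§4) at the old
levels. [cite: Balaban1985UV3, (30) p.263, (33) p.264, (43) p.266, (57) p.270] -/
def TaylorSplitΦ (PT : TermFn F) (Φ : ChartFam 𝕍 F) (e : VacFam F) (B : CfgFam 𝕍 F) (R : RemFam F) : Prop :=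
  ∀ (K k b : ℕ) (Y : Set (Site (F.P K) 0)) (W : GaugeField (F.P K) k (Matrix.specialUnitaryGroup (Fin 2) ℂ)),
    PT K k (1 + b) Y W = e K b Y + (jet26 (Φ K b Y) (B K k b Y W)).re + R K k b Y W

/-- **K1a — FLAT-KERNEL CAUCHY ROW in operator norm (the unprinted NUMBER comparison; [King1986] Prop. 3.6 (3.56) for SU(2), d = 3)**: for `2 ≤ d ≤ 6` the
transported order-`d` kernel of run `K+1` at `(b+1, refineSet Y)` and the order-`d` kernel of run `K` at `(b, Y)` differ by `C·e^{−κ𝓛_K(Y)}·(L^{−(1+b)})^a` —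
ONE chart family `Φ` for all `K` (canonicity, F-g4-1). [cite: King1986, Prop. 3.6 (3.56) p.662, Prop. 3.9 (3.74) p.665] -/
def FlatKernelCauchyΦ (D : AlphaDataT3 F γ) (Φ : ChartFam 𝕍 F) (κ a C : ℝ) : Prop :=
  ∀ (K k b : ℕ) (Y : Set (Site (F.P K) 0)), Y ∈ D.Loc K k (D.triv K k) (1 + b) →
    ∀ d ∈ Finset.Ico 2 7,
      ‖kerT Φ K b Y d - ker Φ K b Y d‖ ≤ C * Real.exp (-κ * D.treeLen K (1 + b) Y) * (((F.L : ℝ) ^ (1 + b))⁻¹) ^ a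

/-- **KERNEL SIZE ROW** (operator norm of the flat kernels; printed type (34) — derivable from the displayed analyticity row `chart` (G3D-01,
`ChartAnalyticityAsCited (Ψ X) ρ (C25·g_k·e^{−κ dj X})`) by Cauchy estimates and polarisation, `d ≤ 6`, radius absorbed). [cite: Balaban1985UV3, Prop. 3 (34) p.264] -/
def KernelSizeΦ (D : AlphaDataT3 F γ) (Φ : ChartFam 𝕍 F) (κ C_E : ℝ) : Prop :=
  ∀ (K k b : ℕ) (Y : Set (Site (F.P K) 0)), Y ∈ D.Loc K k (D.triv K k) (1 + b) →
    ∀ d ∈ Finset.Ico 2 7, ‖ker Φ K b Y d‖ ≤ C_E * Real.exp (-κ * D.treeLen K (1 + b) Y)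

/-- **REMAINDER ROW** (the rest `R` of `TaylorSplitΦ`, both runs): in the lane's currency `R` at the birth level is MINUS the displayed far terms (`hPY`:
`PY = Σ_X (jet26 Ψ_X (Bcfg X)).re − far X`), sized by the displayed row `far_le` (G3D-06, `Cfar·g_b⁷(r p)⁷`-small) — so this row is DERIVABLE there (up to the
polylogarithm-into-power absorption of ideator 2's N8 §1–§2); at the old levels it is the `Rfar` of (M1).  Level factor `x⁴` only (order-≥2 monomials with one
far leg), not `x¹⁴`. [cite: Balaban1985UV3, (57) p.270, p.264 L15-16] -/
def RemainderSmallΦ (D : AlphaDataT3 F γ) (R : RemFam F) (b₀ p₀ κ C_R : ℝ) : Prop :=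
  ∀ (K n : ℕ) (h : n ≤ K), ∀ j : ℕ, j < K - n →
    ∀ V : GaugeField (F.P n) 0 (Matrix.specialUnitaryGroup (Fin 2) ℂ), PlaqSmall (θBal F.L γ b₀ p₀ n) V →
      ∀ Y ∈ D.Loc K (K - n) (D.triv K (K - n)) (1 + j),
        |R K (K - n) j Y
            (fieldShift (F.sitesPerDir_eq (m := F.m) (K := K) (j := K - n) (m' := F.m) (K' := n) (j' := 0) (by omega)) V)| ≤
          C_R * Real.exp (-κ * D.treeLen K (1 + j) Y) * θBal F.L γ b₀ p₀ n ^ 7 * (((F.L : ℝ) ^ (K - n - 1 - j))⁻¹) ^ 4 ∧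
        |R (K + 1) (K + 1 - n) (j + 1) (refineSet F K Y)
            (fieldShift (F.sitesPerDir_eq (m := F.m) (K := K + 1) (j := K + 1 - n) (m' := F.m) (K' := n) (j' := 0) (by omega)) V)| ≤
          C_R * Real.exp (-κ * D.treeLen K (1 + j) Y) * θBal F.L γ b₀ p₀ n ^ 7 * (((F.L : ℝ) ^ (K - n - 1 - j))⁻¹) ^ 4

/-- **CONFIGURATION SIZE ROW** (sup norm; card 8 `ChartCfgSize`; run `K+1`'s configuration pulled back along `matchBond`). [cite: Balaban1985UV3, (28) p.263, (44) p.267] -/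
def CfgSizeΦ (D : AlphaDataT3 F γ) (B : CfgFam 𝕍 F) (b₀ p₀ C_s : ℝ) : Prop :=
  ∀ (K n : ℕ) (h : n ≤ K), ∀ j : ℕ, j < K - n →
    ∀ V : GaugeField (F.P n) 0 (Matrix.specialUnitaryGroup (Fin 2) ℂ), PlaqSmall (θBal F.L γ b₀ p₀ n) V →
      ∀ Y ∈ D.Loc K (K - n) (D.triv K (K - n)) (1 + j),
        ‖B K (K - n) j Y
            (fieldShift (F.sitesPerDir_eq (m := F.m) (K := K) (j := K - n) (m' := F.m) (K' := n) (j' := 0) (by omega)) V)‖ ≤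
          C_s * θBal F.L γ b₀ p₀ n * (((F.L : ℝ) ^ (K - n - 1 - j))⁻¹) ^ 2 ∧
        ‖(fun c => B (K + 1) (K + 1 - n) (j + 1) (refineSet F K Y)
            (fieldShift (F.sitesPerDir_eq (m := F.m) (K := K + 1) (j := K + 1 - n) (m' := F.m) (K' := n) (j' := 0) (by omega)) V)
            (matchBond F K j c))‖ ≤
          C_s * θBal F.L γ b₀ p₀ n * (((F.L : ℝ) ^ (K - n - 1 - j))⁻¹) ^ 2

/-- **CONFIGURATION CAUCHY ROW WITH A LOSS `ℓ(n) ≥ 1`** (sup norm; card 8 `ChartCfgCauchy` = card 5 / stmt-19200 in chart currency — the 19200-side [7]/F4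
content; `ℓ ≡ 1` is the loss-free row of record, `ℓ(n) = L^{n/2}` is [King1986]'s located per-site loss at the two runs' background comparison (3.72) p.665,
OWNER RULING g20-№11 ADDENDUM 2). [cite: King1986, Prop. 3.9 (3.71) p.665, (3.72) p.665] -/
def CfgCauchyΦ (D : AlphaDataT3 F γ) (B : CfgFam 𝕍 F) (b₀ p₀ a C_B : ℝ) (ℓ : ℕ → ℝ) : Prop :=
  ∀ (K n : ℕ) (h : n ≤ K), ∀ j : ℕ, j < K - n →
    ∀ V : GaugeField (F.P n) 0 (Matrix.specialUnitaryGroup (Fin 2) ℂ), PlaqSmall (θBal F.L γ b₀ p₀ n) V →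
      ∀ Y ∈ D.Loc K (K - n) (D.triv K (K - n)) (1 + j),
        ‖(fun c => B (K + 1) (K + 1 - n) (j + 1) (refineSet F K Y)
              (fieldShift (F.sitesPerDir_eq (m := F.m) (K := K + 1) (j := K + 1 - n) (m' := F.m) (K' := n) (j' := 0) (by omega)) V)
              (matchBond F K j c)) -
            B K (K - n) j Y
              (fieldShift (F.sitesPerDir_eq (m := F.m) (K := K) (j := K - n) (m' := F.m) (K' := n) (j' := 0) (by omega)) V)‖ ≤
          C_B * θBal F.L γ b₀ p₀ n * (((F.L : ℝ) ^ (K - n - 1 - j))⁻¹) ^ 2 * (ℓ n * (((F.L : ℝ) ^ (1 + j))⁻¹) ^ a)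

end Rows

end Summit.QuantumFields.YangMills.Theorems.GlobalSlackKernelMatching

end
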